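import Summits.AnomalousDissipation.AnomalousDissipation.Theorems.SolenoidalFractalHomogenisationLagrangianStepSidebandXGen
import Summits.AnomalousDissipation.AnomalousDissipation.Theorems.SolenoidalFractalHomogenisationLagrangianStepCellChainFastSlaving
import HarnessLib

/-!
# K1L_D `LagrangianRenormalisationStepDesign` (stmt-AnomalousDissipation-27980), `stub_D1_V0` (V0 = clause (ii) of
# `WCrossing.D1ExactFamily`), brick T4c-3 (a priori): THE SLOW MODE AND THE BOX VECTOR ARE BOUNDED BY THE ENERGY AT EVERY TIME
# (helper; `--kind proof --supports stmt-AnomalousDissipation-27980 --as helper`)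

Summits-side helper file of route `SolenoidalFractalHomogenisation` (prover seat `ad-k1l-cellLawV-w1` g6).  Everything proved; no definitions, no named
facts, no sorry.  The defect group D3 of the V0 residual (`…SidebandXDefectSmall.norm_slowRHS_le`) needs a POINTWISE-in-time bound of `‖Z t‖` and `‖x t‖`;
the energy representative `E` of `CellChain.exists_energyRep_cell` is continuous, antitone, `E 0 = ‖F‖²`, `E t = ‖u t‖²` a.e., and
`CellChain.norm_sq_le_fastEnergy` turns the a.e. Parseval bound into an everywhere bound for the continuous representatives:
* `classFreq_injective` (`n ≥ 1`), `classFreq_ne_self` (`k_z ≠ ℓ` on the box);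
* `norm_sq_sbVec_eq_sum` — `‖Z t‖² = Σ_{k ∈ classFreq n ℓ '' box} ‖modeRep k t‖²`;
* **`norm_sq_slow_add_sbVec_le`** — `‖x t‖² + ‖Z t‖² ≤ E t` for every `t ∈ [0,T]` (hence `≤ E 0 = ∫‖F‖²`).
NOT a proof of any registered stub, of K1L_D, or of anomalous dissipation; rung F-D1.A0 infrastructure.
-/

set_option linter.dupNamespace false

noncomputable section

namespace Summit.AnomalousDissipation.AnomalousDissipation.Theorems.SolenoidalFractalHomogenisation.LagrangianStep.Sideband

open Set MeasureTheory Complex UnitAddTorus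
open scoped InnerProductSpace
open Literature.Analysis Literature.Analysis.FunctionSpaces Literature.Analysis.FunctionSpaces.Torus
open Literature.Analysis.FluidPDE Literature.Analysis.FluidPDE.Torus Literature.Analysis.FluidPDE.LatticeShear
open Summit.AnomalousDissipation.AnomalousDissipation.Theorems.SolenoidalFractalHomogenisation.LagrangianStep.CellChain (modeRep norm_sq_le_fastEnergy)

variable {k₀ : ℕ}

/-- `z ↦ k_z` is injective (`n ≥ 1`). [cite: MajdaKramer1999, §2.2.1.3] -/
theorem classFreq_injective {n : ℕ} (hn : n ≠ 0) (ℓ : Fin 3 → ℤ) : Function.Injective (classFreq n ℓ) := by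
  intro z z' h
  funext i
  have := congrFun h i
  simp only [classFreq_apply, add_right_inj] at this
  exact mul_left_cancel₀ (by exact_mod_cast hn : (n : ℤ) ≠ 0) this

/-- `k_z ≠ ℓ` for `z ∈ box R` (`n ≥ 1`). [cite: MajdaKramer1999, §2.2.1.3] -/
theorem classFreq_ne_self {n : ℕ} (hn : n ≠ 0) (ℓ : Fin 3 → ℤ) {R : ℕ} (z : box R) : classFreq n ℓ z.1 ≠ ℓ := by
  intro h
  have h0 : classFreq n ℓ z.1 = classFreq n ℓ 0 := by rw [h, classFreq_zero]
  exact ne_zero_of_mem_box z.2 (classFreq_injective hn ℓ h0)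

/-- `‖Z t‖² = Σ_{k ∈ classFreq n ℓ '' box} ‖modeRep k t‖²`. [cite: MajdaKramer1999, §2.2.1.3] -/
theorem norm_sq_sbVec_eq_sum (W₁ : LatticeWord k₀) {n : ℕ} (hn : n ≠ 0) (𝔹 : Torus.Visc4 (Fin 3))
    (F : UnitAddTorus (Fin 3) → EuclideanSpace ℝ (Fin 3)) (u : ℝ → UnitAddTorus (Fin 3) → EuclideanSpace ℝ (Fin 3)) (ℓ : Fin 3 → ℤ) (R : ℕ) (t : ℝ) :
    ‖sbVec W₁ n 𝔹 F u ℓ R t‖ ^ 2 = ∑ k ∈ (box R).image (classFreq n ℓ), ‖modeRep W₁ n 𝔹 F u k t‖ ^ 2 := by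
  classical
  rw [PiLp.norm_sq_eq_of_L2, Finset.sum_image (fun z _ z' _ h => classFreq_injective hn ℓ h)]
  rw [← Finset.sum_coe_sort (box R)]
  exact Finset.sum_congr rfl fun z _ => by rw [sbVec_apply]

/-- **A PRIORI BOUND**: with the energy representative `E` of `CellChain.exists_energyRep_cell` (continuous on `[0,T]`, `E t = ‖u t‖²` a.e.),
`‖x t‖² + ‖Z t‖² ≤ E t` for EVERY `t ∈ [0,T]` (`n ≥ 1`). [cite: Temam1984, Ch. III §1 Lemma 1.2 (energy inequality)] -/
theorem norm_sq_slow_add_sbVec_le (W₁ : LatticeWord k₀) {n : ℕ} (hn : n ≠ 0) {T : ℝ} (hT : 0 < T) {𝔹 : Torus.Visc4 (Fin 3)}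
    {F : UnitAddTorus (Fin 3) → EuclideanSpace ℝ (Fin 3)} {u : ℝ → UnitAddTorus (Fin 3) → EuclideanSpace ℝ (Fin 3)}
    (h : Torus.IsWeakTensorPassiveVectorOn 0 T 𝔹 (W₁.cell n) F u) (hF : Integrable F volume)
    {E : ℝ → ℝ} (hEc : ContinuousOn E (Icc 0 T)) (hE : ∀ᵐ t ∂(volume.restrict (Ioo 0 T)), E t = ∫ x, ‖u t x‖ ^ 2)
    (ℓ : Fin 3 → ℤ) (R : ℕ) {t : ℝ} (ht : t ∈ Icc 0 T) :
    ‖modeRep W₁ n 𝔹 F u ℓ t‖ ^ 2 + ‖sbVec W₁ n 𝔹 F u ℓ R t‖ ^ 2 ≤ E t := by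
  classical
  have hnot : ℓ ∉ (box R).image (classFreq n ℓ) := by
    intro hmem
    obtain ⟨z, hz, hzℓ⟩ := Finset.mem_image.1 hmem
    exact classFreq_ne_self hn ℓ ⟨z, hz⟩ hzℓ
  have hmain := norm_sq_le_fastEnergy W₁ n hT h hF hEc hE ((box R).image (classFreq n ℓ)) hnot t ht
  rw [norm_sq_sbVec_eq_sum W₁ hn 𝔹 F u ℓ R t]
  linarith

end Summit.AnomalousDissipation.AnomalousDissipation.Theorems.SolenoidalFractalHomogenisation.LagrangianStep.Sideband

end
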